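import Summits.BirchSwinnertonDyer.BirchSwinnertonDyer.Theorems.SignedLowerHalvesSprungLowerDivisibilityAtThreeIotaStability
import Summits.BirchSwinnertonDyer.BirchSwinnertonDyer.Theorems.SignedLowerHalvesSprungLowerDivisibilityAtThreeEisensteinRigidity
import Literature.NumberTheory.EllipticCurves.IwasawaAlgebraStructureProofs
import HarnessLib

/-!
# Crux `SprungLowerDivisibilityAtThree` (K1, item stmt-BirchSwinnertonDyer-19875), line `chromatic-common-zeros`:
# ι-RIGIDITY — at EQUAL MINIMAL `λ` (`λ♯ = λ♭ = 2` at `r_an = 0`, `λ♯ = λ♭ = 3` at `r_an = 1`) the span datum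
# `(L♯) ≠ (L♭)` alone excludes every common height-one prime (off `(T)`), WHATEVER the valuation of the leading
# coefficients — doors (R10)/(R11), the higher-valuation complement of Eisenstein rigidity (R9)/(R9′)

Cell `bsd-ssimc` (host), width seat `cruxlead-stmt-BirchSwinnertonDyer-19875-w3` (gen 4) under the 19875 lead;
`--supports` 19875 `--as helper`; theorems only; route-independent imports; closes NO item (skeleton v8 unchanged).
K1, BSD and leaf X8 are NOT proved by anything here; every per-pair hypothesis below is a displayed DATUM (census
input) or a displayed named fact.

## The mechanism (new): the functional equation acts on the common-zero locus

By `ChromaticIota.ClassX8.subst_invOnePlusSubOne_mem_of_mem` (previous file; from the PROVED trace-coordinate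
functional equation and the integral transition matrix of the half-logarithm matrix) the ideal `(L♯, L♭) ⊂ Λ` of an
X8 Sprung pair is stable under `ι : T ↦ (1+T)⁻¹ − 1`. Consequently (§2, `ClassX8.rootSymm`) a common root
`a ∈ 𝔪 ∖ {0}` of the pair comes with its PARTNER `a′ = (1+a)⁻¹ − 1`, and `a′ ≠ a` because the only fixed points
of `ι` on the open disc are `0` and `−2 ∉ 𝔪` (`p ≠ 2`; `partner_mem_ne`).

* §1 (pure `Λ = ℤ_p⟦T⟧` algebra, `p ≠ 2`) **`not_mem_and_mem_of_lam_two_of_rootSymm`**: `F, G ≠ 0`, `μ = 0`,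
  `λ(F) = λ(G) = 2`, `F(0) ≠ 0`, root-symmetric, `(F) ≠ (G)` ⟹ no height-one prime contains both. A common
  prime is `(f)`, `f` distinguished irreducible dividing both Weierstrass polynomials `P_F, P_G` (degree 2,
  `dvd_weierstrassDistinguished_of_mem` via `Λ/(f) ≅ ℤ_p[T]/(f)`); `deg f = 2` gives `P_F = f = P_G`; `deg f = 1`,
  `f = T − a`, gives the two distinct roots `a, a′` of both, so `P_F = (T−a)(T−a′) = P_G`
  (`coeff_eq_of_isRoot_of_isRoot`); either way `(F) = (P_F) = (P_G) = (G)`. `T`-shifted twin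
  `not_mem_and_mem_of_X_mul_of_lam_two_of_rootSymm` (primes other than `(T)`).
* §2 (X8) `ClassX8.rootSymm` — root symmetry of every X8 Sprung pair.
* The X8 doors (R10)/(R11) built on this are in the companion file `…IotaRigidityDoor.lean`:
  `μ♯ = μ♭ = 0`, `λ♯ = λ♭ = 2` (resp. `= 3` at `r_an = 1`), non-zero leading coefficients and `(L♯) ≠ (L♭)` ⟹ K1
  for BOTH colours via (R0) (resp. (R3)).

REACH (x8 census `ty3/data/r5/x8_r5_chromatic_n5_j299803.tsv`, DATA, 217 cells): 66 rank-0 cells have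
`λ♯ = λ♭ = 2` and 31 rank-1 cells have `λ♯ = λ♭ = 3` (their `L^•(0)` resp. `L^•₁` of EVERY valuation; 41 + 21 of them
carry the numerical verdict «suspect»); (R9)/(R9′) (w2 g3 / w3 g3) need `v₃ = 1`, these doors do not. The one datum is
`(L♯) ≠ (L♭)` (x8 tooling: ref g18's integrality certificate «crit2» / `span_ne_of_cross_coeff_not_dvd`). Sanity (DATA,
not used): on all 217 cells `λ♯ ≡ λ♭ ≡ r_an (mod 2)`, as the `ι`-pairing of non-zero roots predicts.

References: [Sprung2017] Thm. 1.1, Prop. 3.14, Thm. 4.13, Cor. 4.14; [GreenbergLNM1716] §1; [Washington1997] §7.1 Thm. 7.3,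
Prop. 7.2, §13.2; [Sprung2012] Prop. 6.14, Thm. 7.14, Prop. 7.19, Main Conj. 7.21; [Kobayashi2013] Cor. 1.3 (i); [Sprung2024]
§5.2 Lemma 5.6.
-/

set_option linter.dupNamespace false
set_option autoImplicit false

noncomputable section

open scoped Classical NumberField MatrixGroups ModularForm Polynomial

open NumberField IsDedekindDomain CongruenceSubgroup WeierstrassCurve Field Polynomial
  Literature.NumberTheory.EllipticCurves Literature.NumberTheory.EllipticCurves.ModularForms
  Literature.NumberTheory.EllipticCurves.ZpExtension Literature.NumberTheory.EllipticCurves.Sprung2017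
  Literature.NumberTheory.EllipticCurves.Sprung2012 Literature.NumberTheory.EllipticCurves.Rank1Residual
  Literature.NumberTheory.EllipticCurves.IwasawaAlgebra Literature.Barriers.BirchSwinnertonDyer
  Summit.BirchSwinnertonDyer.BirchSwinnertonDyer.Theorems
  Summit.BirchSwinnertonDyer.BirchSwinnertonDyer.Theorems.ChromaticCommonZeros
  Summit.BirchSwinnertonDyer.BirchSwinnertonDyer.Theorems.ChromaticSlopeSeparation
  Summit.BirchSwinnertonDyer.Rank1Residual.Supersingular
  Summit.BirchSwinnertonDyer.Rank1Residual.X1.MuLambda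

namespace Summit.BirchSwinnertonDyer.BirchSwinnertonDyer.Theorems.ChromaticIota

section Algebra

variable {p : ℕ} [hp : Fact p.Prime]

/-! ### §1 Divisibility by a distinguished polynomial in `Λ` is divisibility in `ℤ_p[T]` -/

/-- For `f` distinguished: `(f : Λ) ∣ (P : Λ)` for a polynomial `P` implies `f ∣ P` in `ℤ_p[T]`
(`Λ/(f) ≅ ℤ_p[T]/(f)`, Weierstrass division). [cite: Washington1997, §7.1 Prop. 7.2] -/
theorem dvd_of_coe_dvd_coe {f P : ℤ_[p][X]} (hf : f.IsDistinguishedAt (IsLocalRing.maximalIdeal ℤ_[p]))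
    (h : (f : IwasawaAlgebra p) ∣ (P : IwasawaAlgebra p)) : f ∣ P := by
  have h0 : Ideal.Quotient.mk (Ideal.span {(f : IwasawaAlgebra p)}) (P : IwasawaAlgebra p) = 0 :=
    Ideal.Quotient.eq_zero_iff_mem.mpr (Ideal.mem_span_singleton.mpr h)
  have h1 : hf.algEquivQuotient (Ideal.Quotient.mk (Ideal.span {f}) P) =
      Ideal.Quotient.mk (Ideal.span {(f : IwasawaAlgebra p)}) (P : IwasawaAlgebra p) := by
    simp [Polynomial.IsDistinguishedAt.algEquivQuotient_apply]
  rw [h0, map_eq_zero_iff _ hf.algEquivQuotient.injective, Ideal.Quotient.eq_zero_iff_mem,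
    Ideal.mem_span_singleton] at h1
  exact h1

/-- The Weierstrass polynomial of `F` (with `μ(F) = 0`) is divisible in `ℤ_p[T]` by every distinguished `f`
with `F ∈ (f) ⊂ Λ`. [cite: Washington1997, §7.1 Thm. 7.3] -/
theorem dvd_weierstrassDistinguished_of_mem {F : IwasawaAlgebra p}
    (hF' : F.map (IsLocalRing.residue ℤ_[p]) ≠ 0) {f : ℤ_[p][X]}
    (hf : f.IsDistinguishedAt (IsLocalRing.maximalIdeal ℤ_[p])) (hmem : F ∈ Ideal.span {(f : IwasawaAlgebra p)}) :
    f ∣ F.weierstrassDistinguished hF' := by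
  apply dvd_of_coe_dvd_coe hf
  have hfac := F.eq_weierstrassDistinguished_mul_weierstrassUnit hF'
  have hU := F.isUnit_weierstrassUnit hF'
  obtain ⟨u, hu⟩ := hU
  rw [Ideal.mem_span_singleton, hfac, ← hu] at hmem
  exact (Units.dvd_mul_right).mp hmem

/-- `deg P_F = λ(F)` for `μ(F) = 0`. [cite: Washington1997, §7.1 Thm. 7.3] -/
theorem natDegree_weierstrassDistinguished_eq_lam {F : IwasawaAlgebra p} (hF : F ≠ 0) (hμ : mu F = 0)
    (hF' : F.map (IsLocalRing.residue ℤ_[p]) ≠ 0) : (F.weierstrassDistinguished hF').natDegree = lam F := by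
  rw [(F.isWeierstrassFactorization_weierstrassDistinguished_weierstrassUnit hF').natDegree_eq_toNat_order_map]
  obtain ⟨-, hord⟩ := red_ne_zero_and_lam_eq_order hF hμ
  change ((red F).order).toNat = lam F
  rw [← hord]
  rfl

/-- `X − a'` for `a' ∈ 𝔪` is distinguished. [cite: Washington1997, §7.1] -/
theorem isDistinguishedAt_X_sub_C {a : ℤ_[p]} (ha : a ∈ IsLocalRing.maximalIdeal ℤ_[p]) :
    (X - C a : ℤ_[p][X]).IsDistinguishedAt (IsLocalRing.maximalIdeal ℤ_[p]) := by
  refine ⟨⟨fun {n} hn => ?_⟩, monic_X_sub_C a⟩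
  rw [natDegree_X_sub_C] at hn
  have hn0 : n = 0 := by omega
  subst hn0
  simpa using ha

/-- In `ℤ_p` (`p ≠ 2`): for `a ∈ 𝔪 ∖ {0}` and `(1 + a)(1 + a') = 1`, the partner `a'` lies in `𝔪`, is nonzero and
differs from `a`. [folklore] -/
theorem partner_mem_ne (hp2 : p ≠ 2) {a a' : ℤ_[p]} (ha : a ∈ IsLocalRing.maximalIdeal ℤ_[p]) (ha0 : a ≠ 0)
    (haa' : (1 + a) * (1 + a') = 1) :
    a' ∈ IsLocalRing.maximalIdeal ℤ_[p] ∧ a' ≠ 0 ∧ a' ≠ a := by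
  have hrel : a' = -(a * (1 + a')) := by linear_combination haa'
  refine ⟨?_, ?_, ?_⟩
  · rw [hrel]
    exact Submodule.neg_mem _ (Ideal.mul_mem_right _ _ ha)
  · intro h0
    rw [h0, add_zero, mul_one] at haa'
    exact ha0 (by linear_combination haa')
  · intro heq
    rw [heq] at haa'
    have hprod : a * (a + 2) = 0 := by linear_combination haa'
    rcases mul_eq_zero.mp hprod with h | h
    · exact ha0 h
    · have h2 : (2 : ℤ_[p]) ∈ IsLocalRing.maximalIdeal ℤ_[p] := by
        have : (2 : ℤ_[p]) = -a := by linear_combination h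
        rw [this]
        exact Submodule.neg_mem _ ha
      rw [IsLocalRing.mem_maximalIdeal, PadicInt.mem_nonunits] at h2
      have h2' : ‖((2 : ℤ) : ℤ_[p])‖ < 1 := by exact_mod_cast h2
      rw [PadicInt.norm_int_lt_one_iff_dvd] at h2'
      have : p ∣ 2 := by exact_mod_cast h2'
      exact hp2 ((Nat.prime_dvd_prime_iff_eq hp.out Nat.prime_two).mp this)

/-- A monic quadratic with the two distinct roots `a ≠ a'` is `(T − a)(T − a')`: its coefficients are
`−(a + a')` and `a·a'`. [folklore] -/
theorem coeff_eq_of_isRoot_of_isRoot {P : ℤ_[p][X]} (hP : P.Monic) (hdeg : P.natDegree = 2) {a a' : ℤ_[p]}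
    (ha : P.IsRoot a) (ha' : P.IsRoot a') (hne : a' ≠ a) :
    P.coeff 1 = -(a + a') ∧ P.coeff 0 = a * a' := by
  have hsum := hP.as_sum
  rw [hdeg, Finset.sum_range_succ, Finset.sum_range_succ, Finset.sum_range_zero, zero_add, pow_zero, mul_one,
    pow_one] at hsum
  have eva : a ^ 2 + P.coeff 1 * a + P.coeff 0 = 0 := by
    have h := ha
    rw [IsRoot.def, hsum] at h
    simp only [eval_add, eval_pow, eval_X, eval_mul, eval_C] at h
    linear_combination h
  have eva' : a' ^ 2 + P.coeff 1 * a' + P.coeff 0 = 0 := by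
    have h := ha'
    rw [IsRoot.def, hsum] at h
    simp only [eval_add, eval_pow, eval_X, eval_mul, eval_C] at h
    linear_combination h
  have hsub : (a' - a) * (a + a' + P.coeff 1) = 0 := by linear_combination eva' - eva
  have hc1 : P.coeff 1 = -(a + a') := by
    have := (mul_eq_zero.mp hsub).resolve_left (sub_ne_zero.mpr hne)
    linear_combination this
  refine ⟨hc1, ?_⟩
  rw [hc1] at eva
  linear_combination eva

/-- A monic quadratic is determined by its two coefficients (private plumbing). [folklore] -/
private theorem eq_of_coeff_eq {P Q : ℤ_[p][X]} (hP : P.Monic) (hQ : Q.Monic) (hdP : P.natDegree = 2)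
    (hdQ : Q.natDegree = 2) (h1 : P.coeff 1 = Q.coeff 1) (h0 : P.coeff 0 = Q.coeff 0) : P = Q := by
  have hsP := hP.as_sum
  have hsQ := hQ.as_sum
  rw [hdP, Finset.sum_range_succ, Finset.sum_range_succ, Finset.sum_range_zero] at hsP
  rw [hdQ, Finset.sum_range_succ, Finset.sum_range_succ, Finset.sum_range_zero] at hsQ
  rw [hsP, hsQ, h1, h0]

/-- **ι-RIGIDITY AT `λ = 2`.** Let `F, G ∈ Λ = ℤ_p⟦T⟧` (`p ≠ 2`), nonzero, with `μ(F) = μ(G) = 0`,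
`λ(F) = λ(G) = 2`, `F(0) ≠ 0`, and suppose the pair is ROOT-SYMMETRIC: whenever both lie in `(T − a)` for some
`a ∈ 𝔪 ∖ {0}`, both lie in `(T − a')` for the partner `a'` with `(1+a)(1+a') = 1` (for an X8 Sprung pair: the
`ι`-stability of the ideal `(L♯, L♭)`). If `(F) ≠ (G)` then NO height-one prime of `Λ` contains both `F` and
`G`: such a prime is `(f)` with `f` distinguished irreducible dividing both Weierstrass polynomials (degree `2`);
`deg f = 2` forces `P_F = f = P_G`, and `deg f = 1`, `f = T − a`, brings the partner root `a' ≠ a`, forcing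
`P_F = (T − a)(T − a') = P_G` — either way `(F) = (P_F) = (P_G) = (G)`.
[cite: Washington1997, §7.1 Thm. 7.3 and §13.2] [cite: GreenbergLNM1716, §1] -/
theorem not_mem_and_mem_of_lam_two_of_rootSymm (hp2 : p ≠ 2) {F G : IwasawaAlgebra p} (hF0 : F ≠ 0)
    (hG0 : G ≠ 0) (hμF : mu F = 0) (hμG : mu G = 0) (hlamF : lam F = 2) (hlamG : lam G = 2)
    (hcF : PowerSeries.constantCoeff F ≠ 0)
    (hsym : ∀ a a' : ℤ_[p], a ∈ IsLocalRing.maximalIdeal ℤ_[p] → a ≠ 0 → (1 + a) * (1 + a') = 1 →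
      F ∈ Ideal.span {(PowerSeries.X - PowerSeries.C a : IwasawaAlgebra p)} →
      G ∈ Ideal.span {(PowerSeries.X - PowerSeries.C a : IwasawaAlgebra p)} →
      F ∈ Ideal.span {(PowerSeries.X - PowerSeries.C a' : IwasawaAlgebra p)} ∧
        G ∈ Ideal.span {(PowerSeries.X - PowerSeries.C a' : IwasawaAlgebra p)})
    (hne : Ideal.span {F} ≠ Ideal.span {G})
    (𝔭 : PrimeSpectrum (IwasawaAlgebra p)) (h1 : 𝔭.asIdeal.height = 1) : ¬ (F ∈ 𝔭.asIdeal ∧ G ∈ 𝔭.asIdeal) := by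
  rintro ⟨hF𝔭, hG𝔭⟩
  have hF' := map_residue_ne_zero_of_mu_eq_zero hF0 hμF
  have hG' := map_residue_ne_zero_of_mu_eq_zero hG0 hμG
  set P := F.weierstrassDistinguished hF' with hPdef
  set Q := G.weierstrassDistinguished hG' with hQdef
  have hPm : P.Monic := (F.isDistinguishedAt_weierstrassDistinguished hF').monic
  have hQm : Q.Monic := (G.isDistinguishedAt_weierstrassDistinguished hG').monic
  have hdP : P.natDegree = 2 := by rw [hPdef, natDegree_weierstrassDistinguished_eq_lam hF0 hμF hF', hlamF]
  have hdQ : Q.natDegree = 2 := by rw [hQdef, natDegree_weierstrassDistinguished_eq_lam hG0 hμG hG', hlamG]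
  -- the conclusion `P = Q` is contradictory
  have hPQ : P ≠ Q := by
    intro hPQ
    apply hne
    rw [span_eq_span_weierstrassDistinguished hF', span_eq_span_weierstrassDistinguished hG', ← hPdef, ← hQdef, hPQ]
  -- coefficient `0` of `P` is nonzero (`F(0) ≠ 0`)
  have hP0 : P.coeff 0 ≠ 0 := by
    intro h0
    have hn := norm_coeff_zero_weierstrassDistinguished hF'
    rw [← hPdef, h0, norm_zero] at hn
    exact hcF (norm_eq_zero.mp hn.symm)
  -- the coefficients `X − a` linear factors of `P` and `Q` coming from a common root pair
  have hpoly : ∀ a : ℤ_[p], a ∈ IsLocalRing.maximalIdeal ℤ_[p] →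
      F ∈ Ideal.span {(PowerSeries.X - PowerSeries.C a : IwasawaAlgebra p)} →
      G ∈ Ideal.span {(PowerSeries.X - PowerSeries.C a : IwasawaAlgebra p)} → P.IsRoot a ∧ Q.IsRoot a := by
    intro a ha hFa hGa
    have hD := isDistinguishedAt_X_sub_C ha
    have hcoe : ((X - C a : ℤ_[p][X]) : IwasawaAlgebra p) = PowerSeries.X - PowerSeries.C a := by
      rw [Polynomial.coe_sub, Polynomial.coe_X, Polynomial.coe_C]
    rw [← hcoe] at hFa hGa
    exact ⟨dvd_iff_isRoot.mp (dvd_weierstrassDistinguished_of_mem hF' hD hFa),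
      dvd_iff_isRoot.mp (dvd_weierstrassDistinguished_of_mem hG' hD hGa)⟩
  rcases IwasawaAlgebra.eq_span_of_height_eq_one p 𝔭.asIdeal h1 with hp𝔭 | ⟨f, hf, hirr, hf𝔭⟩
  · -- `𝔭 = (p)`: contradicts `μ(F) = 0`
    rw [hp𝔭, Ideal.mem_span_singleton] at hF𝔭
    have h1' : 1 ≤ mu F := le_mu_of_C_pow_dvd hF0 (by rwa [pow_one])
    omega
  · rw [hf𝔭] at hF𝔭 hG𝔭
    have hfP : f ∣ P := dvd_weierstrassDistinguished_of_mem hF' hf hF𝔭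
    have hfQ : f ∣ Q := dvd_weierstrassDistinguished_of_mem hG' hf hG𝔭
    have hfdeg : f.natDegree ≤ 2 := hdP ▸ natDegree_le_of_dvd hfP hPm.ne_zero
    have hfpos : 0 < f.natDegree := by
      by_contra hle
      have h0 : f.natDegree = 0 := by omega
      exact hirr.not_isUnit (by rw [Polynomial.eq_one_of_monic_natDegree_zero hf.monic h0]; exact isUnit_one)
    by_cases h2 : f.natDegree = 2
    · -- `P = f = Q`
      exact hPQ ((eq_of_monic_of_dvd_of_natDegree_le hf.monic hPm hfP (by omega)).trans
        (eq_of_monic_of_dvd_of_natDegree_le hf.monic hQm hfQ (by omega)).symm)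
    · -- `f = T − a`, `a ∈ 𝔪 ∖ {0}`; the partner root `a'`
      have hf1 : f.natDegree = 1 := by omega
      set a : ℤ_[p] := -f.coeff 0 with hadef
      have hfa : f = X - C a := by
        rw [hf.monic.eq_X_add_C hf1, hadef, map_neg, sub_neg_eq_add]
      have ha𝔪 : a ∈ IsLocalRing.maximalIdeal ℤ_[p] := by
        rw [hadef]
        exact Submodule.neg_mem _ (hf.mem (by omega))
      have hcoe : ((f : ℤ_[p][X]) : IwasawaAlgebra p) = PowerSeries.X - PowerSeries.C a := by
        rw [hfa, Polynomial.coe_sub, Polynomial.coe_X, Polynomial.coe_C]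
      rw [hcoe] at hF𝔭 hG𝔭
      obtain ⟨hPa, hQa⟩ := hpoly a ha𝔪 hF𝔭 hG𝔭
      have ha0 : a ≠ 0 := by
        intro h0
        apply hP0
        have := hPa
        rw [h0, IsRoot.def, ← coeff_zero_eq_eval_zero] at this
        exact this
      -- `1 + a` is a unit of the local ring `ℤ_p`
      have hu : IsUnit (1 + a) := by
        by_contra hnu
        have hm : 1 + a ∈ IsLocalRing.maximalIdeal ℤ_[p] :=
          (IsLocalRing.mem_maximalIdeal _).mpr (mem_nonunits_iff.mpr hnu)
        have h1m : (1 : ℤ_[p]) ∈ IsLocalRing.maximalIdeal ℤ_[p] := by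
          have := Ideal.sub_mem _ hm ha𝔪
          rwa [add_sub_cancel_right] at this
        exact (IsLocalRing.maximalIdeal.isMaximal ℤ_[p]).ne_top (Ideal.eq_top_of_isUnit_mem _ h1m isUnit_one)
      set a' : ℤ_[p] := (hu.unit⁻¹ : ℤ_[p]ˣ) - 1 with ha'def
      have haa' : (1 + a) * (1 + a') = 1 := by
        rw [ha'def, add_sub_cancel, IsUnit.mul_val_inv]
      obtain ⟨ha'𝔪, -, ha'ne⟩ := partner_mem_ne hp2 ha𝔪 ha0 haa'
      obtain ⟨hFa', hGa'⟩ := hsym a a' ha𝔪 ha0 haa' hF𝔭 hG𝔭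
      obtain ⟨hPa', hQa'⟩ := hpoly a' ha'𝔪 hFa' hGa'
      obtain ⟨hP1, hP0'⟩ := coeff_eq_of_isRoot_of_isRoot hPm hdP hPa hPa' ha'ne
      obtain ⟨hQ1, hQ0'⟩ := coeff_eq_of_isRoot_of_isRoot hQm hdQ hQa hQa' ha'ne
      exact hPQ (eq_of_coeff_eq hPm hQm hdP hdQ (hP1.trans hQ1.symm) (hP0'.trans hQ0'.symm))

/-- **The `T`-shifted form (analytic rank one).** If `F = T·F₁`, `G = T·G₁` with `F₁, G₁` as in
`not_mem_and_mem_of_lam_two_of_rootSymm` (`μ = 0`, `λ = 2`, `F₁(0) ≠ 0`, `(F₁) ≠ (G₁)`) and the pair `(F, G)` is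
root-symmetric, then no height-one prime OTHER THAN `(T)` contains both `F` and `G`. [cite: Washington1997, §7.1 Thm. 7.3 and §13.2] -/
theorem not_mem_and_mem_of_X_mul_of_lam_two_of_rootSymm (hp2 : p ≠ 2) {F G F₁ G₁ : IwasawaAlgebra p}
    (hFF : F = PowerSeries.X * F₁) (hGG : G = PowerSeries.X * G₁) (hF0 : F₁ ≠ 0) (hG0 : G₁ ≠ 0)
    (hμF : mu F₁ = 0) (hμG : mu G₁ = 0) (hlamF : lam F₁ = 2) (hlamG : lam G₁ = 2)
    (hcF : PowerSeries.constantCoeff F₁ ≠ 0)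
    (hsym : ∀ a a' : ℤ_[p], a ∈ IsLocalRing.maximalIdeal ℤ_[p] → a ≠ 0 → (1 + a) * (1 + a') = 1 →
      F ∈ Ideal.span {(PowerSeries.X - PowerSeries.C a : IwasawaAlgebra p)} →
      G ∈ Ideal.span {(PowerSeries.X - PowerSeries.C a : IwasawaAlgebra p)} →
      F ∈ Ideal.span {(PowerSeries.X - PowerSeries.C a' : IwasawaAlgebra p)} ∧
        G ∈ Ideal.span {(PowerSeries.X - PowerSeries.C a' : IwasawaAlgebra p)})
    (hne : Ideal.span {F₁} ≠ Ideal.span {G₁})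
    (𝔭 : PrimeSpectrum (IwasawaAlgebra p)) (h1 : 𝔭.asIdeal.height = 1)
    (hT : (PowerSeries.X : IwasawaAlgebra p) ∉ 𝔭.asIdeal) : ¬ (F ∈ 𝔭.asIdeal ∧ G ∈ 𝔭.asIdeal) := by
  rintro ⟨hF𝔭, hG𝔭⟩
  rw [hFF] at hF𝔭
  rw [hGG] at hG𝔭
  have hF₁ : F₁ ∈ 𝔭.asIdeal := (𝔭.isPrime.mem_or_mem hF𝔭).resolve_left hT
  have hG₁ : G₁ ∈ 𝔭.asIdeal := (𝔭.isPrime.mem_or_mem hG𝔭).resolve_left hT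
  -- root symmetry descends from `(F, G)` to `(F₁, G₁)`: `(T − a')` is prime and does not contain `T`
  have hsym₁ : ∀ a a' : ℤ_[p], a ∈ IsLocalRing.maximalIdeal ℤ_[p] → a ≠ 0 → (1 + a) * (1 + a') = 1 →
      F₁ ∈ Ideal.span {(PowerSeries.X - PowerSeries.C a : IwasawaAlgebra p)} →
      G₁ ∈ Ideal.span {(PowerSeries.X - PowerSeries.C a : IwasawaAlgebra p)} →
      F₁ ∈ Ideal.span {(PowerSeries.X - PowerSeries.C a' : IwasawaAlgebra p)} ∧
        G₁ ∈ Ideal.span {(PowerSeries.X - PowerSeries.C a' : IwasawaAlgebra p)} := by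
    intro a a' ha ha0 haa' hFa hGa
    obtain ⟨ha'𝔪, ha'0, -⟩ := partner_mem_ne hp2 ha ha0 haa'
    set J : Ideal (IwasawaAlgebra p) := Ideal.span {(PowerSeries.X - PowerSeries.C a' : IwasawaAlgebra p)}
      with hJ
    have hcoe : ((X - C a' : ℤ_[p][X]) : IwasawaAlgebra p) = PowerSeries.X - PowerSeries.C a' := by
      rw [Polynomial.coe_sub, Polynomial.coe_X, Polynomial.coe_C]
    haveI hJp : J.IsPrime := by
      rw [hJ, ← hcoe]
      exact IwasawaAlgebra.isPrime_span_coe p (isDistinguishedAt_X_sub_C ha'𝔪) (irreducible_X_sub_C a')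
    have hXJ : (PowerSeries.X : IwasawaAlgebra p) ∉ J := by
      intro hX
      rw [hJ, ← hcoe, ← Polynomial.coe_X, Ideal.mem_span_singleton] at hX
      have hroot := dvd_iff_isRoot.mp (dvd_of_coe_dvd_coe (isDistinguishedAt_X_sub_C ha'𝔪) hX)
      rw [IsRoot.def, eval_X] at hroot
      exact ha'0 hroot
    have hFmem : F ∈ Ideal.span {(PowerSeries.X - PowerSeries.C a : IwasawaAlgebra p)} := by
      rw [hFF]; exact Ideal.mul_mem_left _ _ hFa
    have hGmem : G ∈ Ideal.span {(PowerSeries.X - PowerSeries.C a : IwasawaAlgebra p)} := by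
      rw [hGG]; exact Ideal.mul_mem_left _ _ hGa
    obtain ⟨hF', hG'⟩ := hsym a a' ha ha0 haa' hFmem hGmem
    rw [hFF] at hF'
    rw [hGG] at hG'
    exact ⟨(hJp.mem_or_mem hF').resolve_left hXJ, (hJp.mem_or_mem hG').resolve_left hXJ⟩
  exact not_mem_and_mem_of_lam_two_of_rootSymm hp2 hF0 hG0 hμF hμG hlamF hlamG hcF hsym₁ hne 𝔭 h1 ⟨hF₁, hG₁⟩

end Algebra

/-! ### §2 X8: root symmetry of a Sprung pair (from the `ι`-stability of `(L♯, L♭)`) -/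

section RootSymm

/-- `ι` carries `(T − a)` into `(T − a′)` when `(1+a)(1+a′) = 1`: `ι − a = −(1+a)(1+ι)(T − a′)`. [cite: GreenbergLNM1716, §1] -/
theorem subst_mem_span_X_sub_C {R : Type*} [CommRing R] {a a' : R} (haa' : (1 + a) * (1 + a') = 1)
    {g : PowerSeries R} (hg : g ∈ Ideal.span {(PowerSeries.X - PowerSeries.C a : PowerSeries R)}) :
    PowerSeries.subst (invOnePlusSubOne : PowerSeries R) g ∈
      Ideal.span {(PowerSeries.X - PowerSeries.C a' : PowerSeries R)} := by
  have hι := hasSubst_invOnePlusSubOne (R := R)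
  obtain ⟨q, rfl⟩ := Ideal.mem_span_singleton'.mp hg
  have hE : (1 + PowerSeries.X : PowerSeries R) * (invOnePlusSubOne + 1) = 1 :=
    one_add_X_mul_invOnePlusSubOne_add_one
  have hCa : PowerSeries.subst (invOnePlusSubOne : PowerSeries R) (PowerSeries.C a : PowerSeries R) =
      PowerSeries.C a := by
    rw [← PowerSeries.coe_substAlgHom hι, PowerSeries.C_eq_algebraMap, AlgHom.commutes]
  have hC : ((1 : PowerSeries R) + PowerSeries.C a) * (1 + PowerSeries.C a') = 1 := by
    have h := congrArg (PowerSeries.C (R := R)) haa'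
    simpa using h
  have hkey : PowerSeries.subst (invOnePlusSubOne : PowerSeries R)
      (PowerSeries.X - PowerSeries.C a : PowerSeries R) =
        -((1 + PowerSeries.C a) * (invOnePlusSubOne + 1)) * (PowerSeries.X - PowerSeries.C a') := by
    rw [PowerSeries.subst_sub hι, PowerSeries.subst_X hι, hCa]
    linear_combination ((1 : PowerSeries R) + PowerSeries.C a) * hE - (invOnePlusSubOne + 1 : PowerSeries R) * hC
  rw [PowerSeries.subst_mul hι, hkey]
  exact Ideal.mul_mem_left _ _ (Ideal.mul_mem_left _ _ (Ideal.subset_span rfl))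

/-- `ι ∘ ι = id` on `Λ` (private plumbing). [folklore] -/
private theorem subst_subst_int {p : ℕ} [Fact p.Prime] (g : IwasawaAlgebra p) :
    PowerSeries.subst (invOnePlusSubOne : IwasawaAlgebra p)
      (PowerSeries.subst (invOnePlusSubOne : IwasawaAlgebra p) g) = g := by
  have hι := hasSubst_invOnePlusSubOne (R := ℤ_[p])
  rw [PowerSeries.subst_comp_subst_apply hι hι, invOnePlusSubOne_subst_self, PowerSeries.X_subst]

variable (W : WeierstrassCurve ℚ) [W.IsElliptic] [W.IsGloballyMinimal] (p : ℕ) [Fact p.Prime]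

/-- **ROOT SYMMETRY of an X8 Sprung pair.** If both colours lie in `(T − a)`, then both lie in `(T − a′)` for the
partner `a′` with `(1+a)(1+a′) = 1` (no condition on `a`): the `ι`-stability of the ideal `(L♯, L♭)`
(`ClassX8.subst_invOnePlusSubOne_mem_of_mem`) and `L = (L(T^ι))(T^ι) ∈ ι(T − a)·Λ ⊆ (T − a′)`.
[cite: Sprung2017, Thm. 4.13 and Cor. 4.14] [cite: GreenbergLNM1716, §1] -/
theorem ClassX8.rootSymm (hX : ClassX8 W p) {N : ℕ} [hN : NeZero N] (f : CuspForm (Gamma0 N) 2)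
    (Lsharp Lflat : IwasawaAlgebra p) (hf : IsNewformOf W f) (hSP : IsSprungPair f p (W.frobeniusTrace p) Lsharp Lflat)
    (a a' : ℤ_[p]) (haa' : (1 + a) * (1 + a') = 1)
    (hs : Lsharp ∈ Ideal.span {(PowerSeries.X - PowerSeries.C a : IwasawaAlgebra p)})
    (hfl : Lflat ∈ Ideal.span {(PowerSeries.X - PowerSeries.C a : IwasawaAlgebra p)}) :
    Lsharp ∈ Ideal.span {(PowerSeries.X - PowerSeries.C a' : IwasawaAlgebra p)} ∧
      Lflat ∈ Ideal.span {(PowerSeries.X - PowerSeries.C a' : IwasawaAlgebra p)} := by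
  obtain ⟨h1, h2⟩ := ClassX8.subst_invOnePlusSubOne_mem_of_mem W p hX N hN f Lsharp Lflat hf hSP _ hs hfl
  refine ⟨?_, ?_⟩
  · rw [← subst_subst_int Lsharp]
    exact subst_mem_span_X_sub_C haa' h1
  · rw [← subst_subst_int Lflat]
    exact subst_mem_span_X_sub_C haa' h2

end RootSymm

end Summit.BirchSwinnertonDyer.BirchSwinnertonDyer.Theorems.ChromaticIota

end
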